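import Literature.NumberTheory.GelbartRogawski1991.WeilLiftNonsplitPrincipalSeriesConstituent
import Literature.NumberTheory.Rogawski1990.XiLocalCharacter
import Summits.HodgeConjecture.HodgeConjecture.Theorems.F0P2oStubDictTorusChar   -- ★ p826011 F0P2-p02 (g5): K2 closer `stubDictTorusChar_holds` (edition v1.1)
import Summits.HodgeConjecture.HodgeConjecture.Theorems.F0P2oThetaInPSOfLetters  -- ★ p828142 B-p18 (g28): K1 composition `stubThetaInPS_of_letters (hN3) (hW) (hU1)` (edition v1.2)
import Literature.NumberTheory.GelbartRogawski1991.ThetaTypeNonsplitJacquetModule   -- ★ p826177 typ-T7a (g0): THE N3 LETTER `thetaType_nonsplit_jacquetModule`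
import Literature.NumberTheory.Rogawski1990.U3PrincipalSeriesWeylConjugate         -- ★ p826332 typ-T7a (g0): THE K1w LETTER `cmPrincipalSeries_isConstituentOf_weylConj`
import Literature.NumberTheory.GelbartRogawski1991.U1ThetaDichotomy                 -- ★ p826953∕p827180 typ-T7b (g0): THE U1 LETTER `u1ThetaDichotomy_nonsplit`
import Summits.HodgeConjecture.HodgeConjecture.Theorems.F0P2pK1wHolds     -- ★ p833012 F0P2-p06 (g2): K1w HYPOTHESIS-FREE `cmPrincipalSeries_isConstituentOf_weylConj_holds` (= ★ p832032 `_of_N1` over ★ p832625 N1), BY NAME («HOLDS FOLD»)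
import Summits.HodgeConjecture.HodgeConjecture.Theorems.F0P2pGR91NOfN3    -- ★ p833094 F0P2-p06 (g2): `u1ThetaDichotomy_nonsplit_of_N3 (hN3)` (U1 modulo N3 only: ★ p829230 tower ∘ ★ p832406∕p833741 CM head ∘ ★ p832625 N1), BY NAME («HOLDS FOLD»)
import Summits.HodgeConjecture.HodgeConjecture.Theorems.F0P2oN3OfTorusWeight   -- ★ p835661 F0P2-p06 (g3): THE N3 PACKAGER `thetaType_nonsplit_jacquetModule_of_a_of_torusWeight (hA) (hD)` over ★ p835430 (b)-assembler `F0P2oN3TorusWeightOfD3d`, BY NAME («N3 SPLIT», edition v1.4)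
import Summits.HodgeConjecture.HodgeConjecture.Theorems.F0P2oN3TorusWeightHolds   -- ★ A-p16 (g24) (5c): `forall_jacquetModule_xThetaGqsCM_torus_eq_smul` = the packager՚s (hD) binder PROVED (token for token) ⇒ `stub_N3D_letter` closed BY NAME («N3D FOLD»)
import Summits.HodgeConjecture.HodgeConjecture.Theorems.F0P2oLineJacquetHolds   -- ★ p839151 F0P2-p06 (g4) (JA): `thetaType_nonsplit_jacquetModule_holds : GelbartRogawski1991.thetaType_nonsplit_jacquetModule` HYPOTHESIS-FREE ⇒ `stub_N3_letter` closed BY NAME («N3 DIRECT FOLD»)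
import HarnessLib

/-!
# Crux `H413`, programme P2 — LOCAL PAY-DOWN of print letter #76 `GR91Lemma512NonsplitAsPrinted` (U′-N): **ξ eliminates — the Weil lift lies in the principal
# series of its OWN torus character (K1, pure local theta) + the dictionary algebra (K2)** (`GR91N_of_stubs`)

Cell hodgecm-mathlib (D-0151), FLOOR 0, crux item H413 = stmt-HodgeConjecture-24833, route of record `HCCMUnconditional` (registered skeleton `Lines/a3_liu413.lean`
v10.3 — this sub-line is NOT recorded against it by its author; the registrar records sub-lines); programme P2, socket 27455 `F0HdictE`, PKΠ line
`Lines/F0_P2PKPiRung4.lean` (:538 `stub_GR91N : GR91Lemma512NonsplitAsPrinted`, letter #76 BY NAME).  Planner F0P2-plan (g7), 2026-08-31 (director s554 PAY-DOWN ask;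
design memo `F0/P2/F0_P2GR91NJacquet.design.F0P2-plan-g7.md`).  HC_CM is proved only modulo the printed citations until rung 0 closes.  This file discharges none of
them: it CUTS letter #76 into two registered stubs and proves the composition.

## Edition v1.5 «N3 DIRECT FOLD» (desk F0P2-plan (g9), 2026-09-01; proof-only for every SURVIVING statement, every surviving statement and head byte-unchanged; the clause-(a) stub `stub_N3a_letter` of v1.4 is DROPPED (N1-DROP precedent: its only consumer was the body of `stub_N3_letter`); supersedes v1.4 354f6b01fc1c).
The N3 letter #96 [GelbartRogawski1991 §3.2 (3.2.1)–(3.2.2) p. 457; Kudla1986 Thm. 2.8] `GelbartRogawski1991.thetaType_nonsplit_jacquetModule` — the LAST local print letter of programme P2 below the packet letters — is ★ CLOSED BY NAME, HYPOTHESIS-FREE, by the η-free (N′) line-Jacquet road: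
`stub_N3_letter := Summit.HodgeConjecture.HodgeConjecture.Cruxes.H413.F0P2oLineJacquetHolds.thetaType_nonsplit_jacquetModule_holds`
(★ p839151 F0P2-p06 (g4) `Theorems/F0P2oLineJacquetHolds.lean :: thetaType_nonsplit_jacquetModule_holds` (the (JA) junction over ★ (C5) p838835 B-p10 (g23), ★ (C6)∕(J1)–(J4) p838314 B-p14 (g29) + `F0P2oLineJacquetReindex`, ★ (BE) p838099∕p838184 B-p18 (g29), ★ (N′) p837961 F0P2-p06 (g4), ★ (LS) p836839, ★ (LM) p836568, ★ (FX)(CC) p837171∕p837965, ★ (BF) p837182, ★ (BD) p838316, ★ (IB) p838392, ★ (KL) p838305, ★ (SJ-gen) p838357; lead B-p18 (g29) socket (B) word 2026-08-31T23:47:37Z); conclusion = the Literature named fact BY NAME; the fold line elaborating is the certificate).  + import ★ `Theorems.F0P2oLineJacquetHolds`.  Sorry set of this file after v1.5: {} — the pay-down line is SORRY-FREE: letter #76 `stubGR91N_of_K1K2 : GR91Lemma512NonsplitAsPrinted` is a THEOREM of the tree HYPOTHESIS-FREE (axioms expected [propext, Classical.choice, Quot.sound]).  BOOKS: #96 N3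 closes on the HYPOTHESIS-FREE Theorems-level proof of `GelbartRogawski1991.thetaType_nonsplit_jacquetModule` (director՚s pen, s527 criterion (i)); this edition is the consumer catch-up BY NAME.
HC_CM is proved only modulo the printed citations until rung 0 closes.

## Edition v1.4 «N3 SPLIT + N3D FOLD» (desk F0P2-plan (g8), 2026-08-31T22Z; director s705 DENOMINATION: #96 N3 stays ONE books row, re-denominated BY NAME to the packager՚s open print inputs; proof-only for every existing statement, heads byte-unchanged; supersedes v1.3 2bb095e251d7).  `stub_N3_letter` [GelbartRogawski1991 §3.2 (3.2.1)–(3.2.2) p. 457; Kudla1986 Thm. 2.8] is ★ CLOSED BY NAME over F0P2-p06 (g3)՚s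
★ p835661 `F0P2oN3OfTorusWeight.thetaType_nonsplit_jacquetModule_of_a_of_torusWeight stub_N3a_letter stub_N3D_letter` (packager over the ★ p835430 (b)-assembler `F0P2oN3TorusWeightOfD3d`: clause (b) of
the letter — the `m(γ)`-weight on `r_N(X_v)` read through the (D3d) undoubling∕coinvariant bricks ★ p834000 · p834249 · p835415 · p835416 · p835417 · p835587 · p835588 · p835613 (A-p16 (g24)) — is PROVED modulo
(hD); clause (a) is (hA)).  TWO NEW PRINT-RESIDUE STUBS, typed TOKEN FOR TOKEN as the packager՚s binders (extracted by script from the TREE bytes dc6083d4a23e6b99 of the ★ file, lines :83–:100 ∕ :101–:117,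
under its `open` ∕ `set_option` context via `set_option … in open … in`; the fold line elaborating is the fidelity certificate): `stub_N3a_letter` = clause (a) «`r_N(X_v(μ, ε, χ_f)) ≃ ℱ_v[ψθ]` as a `C`-line: the Borel
coinvariants of `X_v` are the `ψθ ∘ det`-weight space of the rank-one line Weil representation» [GelbartRogawski1991 §3.2 (3.2.1) p. 457; Kudla1986 Thm. 2.8 (top filtration piece = ev₀)] (in-house road, lead B-p18 (g29):
(S4) ★ p834408 ∘ CM closer ★ p832817 ∘ chart sockets ★ p834949∕p835111 (A-p12 (g17)) ∘ F0P2-p01 (g8)՚s (E1) ★ p835408 ∕ (E2) ∕ (E3) ★ p835407 ∕ (N) ∕ (W) dictionary; B-p18 (g29) 22:04:27Z rows (LS) local see-saw + (FN) frame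
naturality; B-p10 (g22) (1b) ★ p835647) and `stub_N3D_letter` = the torus weight «`m(γ)` acts on `r_N(X_v)` by `μ_w(γ)‖γ‖_w^{1/2}`» [Kudla1986 Thm. 2.8; Rogawski1990 §12.2 (2) p. 174] (in-house: A-p16 (g24)՚s (5b) CM-package
wrapper `Theorems/F0P2oThetaJacquetTorusWeight.lean` over ★ p835613 (5a) ⇒ ★ `F0P2oN3TorusWeightOfD3d.thetaType_nonsplit_jacquetModule_b_of_kerWeight`, ★ p835944; and (5c) ★ p836093 `F0P2oN3TorusWeightHolds.forall_jacquetModule_xThetaGqsCM_torus_eq_smul` PROVES the (hD) binder token for token ⇒ `stub_N3D_letter` is ★ CLOSED BY NAME in this edition — #96 N3 hinges on clause (a) ALONE).  Sorry set of this file after v1.4: {`stub_N3a_letter`} — letter #76 `GR91Lemma512NonsplitAsPrinted` ⟸ {N3 (a)} kernel-checked.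
HC_CM is proved only modulo the printed citations until rung 0 closes.

## Edition v1.3 «HOLDS FOLD — LETTER #76 ⟸ ONE PRINT LETTER (N3)» (desk F0P2-plan (g8), 2026-08-31T22Z; proof-only: targets §1 and head §3 byte-unchanged; supersedes v1.2 bc8c0266be4a)
`stub_K1w_letter := F0P2pK1wHolds.cmPrincipalSeries_isConstituentOf_weylConj_holds` (★ p833012 F0P2-p06 (g2): K1w HYPOTHESIS-FREE over ★ p832032 + ★ p832625 N1; #107 CLOSED s671, #98 CLOSED-derived s677)
and `stub_U1_letter := F0P2pGR91NOfN3.u1ThetaDichotomy_nonsplit_of_N3 stub_N3_letter` (★ p833094 F0P2-p06 (g2): U1 MODULO N3 ONLY — ★ p829230 tower ∘ ★ p832406∕p833741 CM head ∘ ★ p832625;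
#97 CLOSED-derived s677); `stub_thetaType_in_principalSeries` keeps its v1.2 by-name composition over the three (two of them now theorems).  Imports + ★ p833012, + ★ p833094 (Lines-free
`Theorems/` files, O50-1 kept).  So letter #76 `GR91Lemma512NonsplitAsPrinted` ⟸ {N3} alone: the ONE `sorry` of this file is `stub_N3_letter` (#96; in-house N3 road live: ★ p835430 F0P2-p06 (g3) (b)-assembler `F0P2oN3TorusWeightOfD3d` + packager `thetaType_nonsplit_jacquetModule_of_a_of_torusWeight (hA) (hD)` GREEN, (a)-side ★ p834861∕p834949∕p835111 A-p12 (g17) + F0P2-p01 (g8) (S5)∕(E·) bricks, (b)-side A-p16 (g24) (D3d) bricks, lead B-p18 (g29)).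
Same fold as T7 v1.4 (8e8104642623), PKΠ v1.11 and the K1 sub-line v3d (★ p833094՚s `GR91Lemma512NonsplitAsPrinted_of_N3 (hN3)` is this file՚s head modulo N3, Lines-free — PKΠ v1.11 uses it for `stub_GR91N`).
HC_CM is proved only modulo the printed citations until rung 0 closes.

## Edition v1.2 «K1 FOLD — THE LINE IS CLOSED MODULO THREE PRINT LETTERS» (lead B-p18 (g28), 2026-08-31T16:2xZ; bytes `F0/P2/B-p18/g28/F0_P2GR91NJacquet.v1.2.B-p18g28.lean`)
K1 `stub_thetaType_in_principalSeries` is ★ CLOSED BY NAME over the `Theorems/` composition ★ p828142 `F0P2oThetaInPSOfLetters.stubThetaInPS_of_letters stub_N3_letter stub_K1w_letter stub_U1_letter`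
(type = the K1 body with the Lines-local Prop `CenterCharSpec` spelled by its token-identical ★ Literature twin `IsThetaCenterChar`; folds by δ).  Under it, BY NAME and all ★: the K1 sub-line
`Cruxes/H413/Lines/F0_P2GR91NJacquetK1.lean` (v3c) — K1aʷ ★ p828026 `F0P2oK1aWOfLetters` (over ★ p827685 N3 ⟹ N3ᵟ, ★ p827347 K1occ, ★ p827378 K1m), K1w ★ p826576 `F0P2oK1wOfWeylConj`,
K1c ★ p827560 `F0P2oXThetaOwnClass`, K1b ★ p825303∕p825579 `F0P2nFrobeniusFunctional`.  Registered engine `sorry`s 1 → 0.  Print letters by name in this file (each a `sorry` over a ★-typed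
`def … : Prop`, a printed citation — the U′-N pay-down's DECLARED RESIDUE): `stub_N3_letter` [GelbartRogawski1991 §3.2 (3.2.1)–(3.2.2) p. 457; Kudla1986 Thm. 2.8] (★ p826177),
`stub_K1w_letter` [Rogawski1990 §12.2 p. 174 L3–5; BernsteinZelevinsky1977 Thm. 2.9] (★ p826332; in-house pay-down F0P2-p06 (g0) in flight), `stub_U1_letter` [HarrisKudlaSweet1996 Cor. 4.4;
Rogawski1992 Prop. 3.4] (★ p826953∕p827180; in-house road (T) «up the tower» in flight).  So letter #76 `GR91Lemma512NonsplitAsPrinted` ⟸ {N3, K1w, U1}: three SMALLER standard local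
statements replace one paper-specific one.  Targets §1 and head §3 byte-unchanged from v1 (8624ae7daed8e64a).
HC_CM is proved only modulo the 2 remaining named inputs (hLiu418, h413) — behind them the booked printed statements + the MOD package — until rung 0 closes.

## Edition v1.1 «K2 FOLD» (F0P2-plan (g7), 2026-08-31)
K2 `stub_dictionary_torusChar` is ★ CLOSED BY NAME, LETTER-FREE: `:= Summit.HodgeConjecture.HodgeConjecture.Cruxes.H413.F0P2oStubDictTorusChar.stubDictTorusChar_holds`
(F0P2-p02 (g5) ★ p826011 `Theorems/F0P2oStubDictTorusChar.lean`, 291 l., 0 def ∕ 0 sorry, axioms TRIO; type = the K2 body with the Lines-local Prop `CenterCharSpec` δ-unfolded —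
python fidelity True, fold cert by paste GREEN (p02 14:42:13Z), twin F0-typ3 (g8); proof = design memo §2 made kernel: DICT(μ) pointwise via ★ `cm_pullback_semilocalComponent`,
conjugate self-duality `μ_v(x∕x̄) = μ_v(x)²`, `det θ(z) = z`, LOCAL HILBERT 90 at non-split `v` (★ `exists_ne_zero_mul_galAdicCompletionMap_eq`), DICT(χ_f) at a `v`-supported
finite idèle ⇒ `ψθ = ψ_v` on `E¹_v`, then ★ `xiTorusChar_apply` on both sides).  AUDIT K0 is ★ in the kernel: B-p18 (g27) p825910 `Theorems/F0P2nXThetaCentralCharacter.lean ::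
xThetaCM_localCenter` — the centre `E¹_v` acts on `xThetaCM … ε v` by `χ_{f,v}` EXACTLY (no `μ_v`-twist), consistent with `CenterCharSpec` (GREEN, no misstatement signal
against #76).  Registered `sorry`s 2 → 1 = {K1 `stub_thetaType_in_principalSeries` (B-p18 (g27) lead + F0P2-p05 (g0); order of work: ORIENTATION of the `GL₁(L_w)`-slot of the
top Kudla quotient first — ref1 r140 N140-2 ∕ r141e — then the crux-plan split K1a functional (`δ_B^{1∕2}` explicit) ∕ K1b ★ p825303+p825579 Frobenius-by-functional BY NAME ∕
K1c own-class typing)}; all other bytes unchanged (targets §1, head §3) but for `set_option linter.dupNamespace false` (ref1 N140-1).  Box of v1: ref1 (g4) r140 (A) CLEAN,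
r141 (A) confirm-on-write CLEAN; K2 desk audit PASS (N140-3); «∃ ε» ∕ «∃ ψθ» print-exact and non-vacuous (N140-4).
HC_CM is proved only modulo the 2 remaining named inputs (hLiu418, h413) — behind them 26 booked printed statements + the MOD package — until rung 0 closes.

## Idea
Under the letter's DICTIONARY hypotheses the endoscopic datum `ξ = (η, ψ)` and Rogawski's `μω` ELIMINATE from the inducing character:
`χ_ξ(d(α,β,ᾱ⁻¹)) = μ_v(α)·‖α‖^{1/2}·ψθ(β)` with `ψθ = χ_{f,v}·μ_v⁻¹` on `E¹_v` (K2, character algebra over ★ `xiTorusChar_apply`, ★ `cm_pullback_semilocalComponent`,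
conjugate-symplectic `μ`).  What is left (K1) is a statement of the LOCAL THETA CORRESPONDENCE for `U(3) × U(1)` at a non-split place alone: Liu's local theta type
`X_v(μ, ε, χ_f)` is a constituent of `i_G(μ_v‖·‖^{1/2} ⊗ ψθ)` — Kudla's Jacquet-module filtration + the `U(1) × U(1)` occurrence + ★ Frobenius reciprocity
(`SmoothInduction.lean` `frobeniusEquiv`, proved).  `ψθ` is a BINDER constrained by the Prop ★ `CenterCharSpec` (no new data is posited).

## Registered stubs (2) and head
| stub | Lean | class ∕ size |
|---|---|---|
| K1 | `stub_thetaType_in_principalSeries : StubThetaInPS` | local theta, L — the ONE `sorry` (lead B-p18 (g27) + F0P2-p05 (g0); crux-plan split K1a functional ∕ K1b Frobenius ★ p825303+p825579 ∕ K1c own-class typing) |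
| K2 | `stub_dictionary_torusChar : StubDictTorusChar` | character algebra + Hilbert 90, M — ★ CLOSED BY NAME (edition v1.1): F0P2-p02 (g5) p826011 `F0P2oStubDictTorusChar.stubDictTorusChar_holds` |
Head: `GR91N_of_stubs : StubThetaInPS → StubDictTorusChar → GR91Lemma512NonsplitAsPrinted` (`obtain` + `rw`), and the concluder `stubGR91N_of_K1K2`.
AUDIT K0 (design memo §3; not in this file, not load-bearing): the centre `E¹_v` of `U(diag dV)(L⁺_v)` acts on `xThetaCM … ε v` by `χ_{f,v}` — ★ p825910 `xThetaCM_localCenter` (GREEN).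

## References
- [GelbartRogawski1991] S. Gelbart, J. Rogawski, *L-functions and Fourier–Jacobi coefficients for the unitary group U(3)*, Invent. Math. 105 (1991) — §5.1 (5.1.1), Lem. 5.1.2.
- [Rogawski1990] J. Rogawski, *Automorphic Representations of Unitary Groups in Three Variables*, Ann. of Math. Stud. 123 — §12.1 p. 172, §12.2 (2) p. 174, §13.1 p. 199.
- [Kudla1986] S. Kudla, *On the local theta-correspondence*, Invent. Math. 83 (1986) 229–255 — Thm. 2.8 (Jacquet modules of the Weil representation).
- [HarrisKudlaSweet1996] M. Harris, S. Kudla, W. J. Sweet, *Theta dichotomy for unitary groups*, JAMS 9 (1996) — §6.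
- [BernsteinZelevinsky1976] I. N. Bernstein, A. V. Zelevinsky, Russian Math. Surveys 31 (1976) — §2.28 (Frobenius reciprocity; ★ `frobeniusEquiv`).
-/

set_option autoImplicit false
set_option linter.dupNamespace false

noncomputable section

open NumberField IsDedekindDomain MeasureTheory
open scoped Matrix

open Literature.NumberTheory Literature.NumberTheory.Automorphic Literature.NumberTheory.Automorphic.UnitaryGroup
open Literature.NumberTheory.Automorphic.IdeleClassGroup
open Literature.NumberTheory.Automorphic.Liu2021 Literature.NumberTheory.Automorphic.Liu2021.Def411WeilCarriers
open Literature.NumberTheory.GaloisRepresentations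
open Literature.NumberTheory.Rogawski1990
open Literature.NumberTheory.GelbartRogawski1991

namespace Summit.HodgeConjecture.HodgeConjecture.Cruxes.H413.F0P2GR91NJacquet

/-! ## §1 The one constraint Prop: the U(1)-character of the theta data read on `E¹_v` -/

set_option synthInstance.maxHeartbeats 400000 in
set_option maxHeartbeats 8000000 in
/-- **`CenterCharSpec L μ χf ε v ψθ` — «`ψθ` is the U(1)-character of the local theta type read on `E¹_v`»**: for every `u` in the local unitary group
`U((ε))(L⁺_v)` of the line (★ `localPi … 1 (JW ε) v`, = `E¹_v` through ★ `localDet`), `ψθ (det u) = χ_{f,v}(u) · μ_v(det u)⁻¹` (★ `localCharOfCenter`, ★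
`HeckeCharacter.semilocalComponent`).  By §2 of the design memo this is the character `ψ_v` of Rogawski's `ξ = (η, ψ)` whenever `(μ, χ_f)` is the dictionary pair of
`ξ` — but it is stated over `(μ, χ_f)` ALONE.  A Prop, no data: the line posits no new character, it constrains a binder. [cite: GelbartRogawski1991, §5.1 (5.1.1) p. 465]
[cite: Rogawski1990, §12.2 (2) p. 174] -/
def CenterCharSpec (L : Type) [Field L] [NumberField L] [IsCMField L]
    (μ : Literature.NumberTheory.Automorphic.IdeleClassGroup L →ₜ* Circle)
    (χf : UnitaryGroup.finAdelicOne (↥(maximalRealSubfield L)) L (IsCMField.complexConj L) →* ℂˣ) (ε : (↥(maximalRealSubfield L))ˣ)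
    (v : HeightOneSpectrum (𝓞 ↥(maximalRealSubfield L))) (ψθ : ↥(normOneUnits (conjLocal L (IsCMField.complexConj L) v)) →* ℂˣ) : Prop :=
  ∀ u : ↥(localPi L (IsCMField.complexConj L) 1 (JW (↥(maximalRealSubfield L)) L ε) v),
    ψθ (localDet (IsCMField.complexConj L) v (isUnit_iff_ne_zero.mpr (by rw [Matrix.det_fin_one]; exact JW_apply_ne_zero (↥(maximalRealSubfield L)) L ε)) (localPiEquiv L (IsCMField.complexConj L) 1 (JW (↥(maximalRealSubfield L)) L ε) v u)) =
      localCharOfCenter (↥(maximalRealSubfield L)) L (IsCMField.complexConj L) (JW (↥(maximalRealSubfield L)) L ε) (JW_apply_ne_zero (↥(maximalRealSubfield L)) L ε) χf v u *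
        ((toHeckeCharacter L μ).semilocalComponent L v
          ((localDet (IsCMField.complexConj L) v (isUnit_iff_ne_zero.mpr (by rw [Matrix.det_fin_one]; exact JW_apply_ne_zero (↥(maximalRealSubfield L)) L ε)) (localPiEquiv L (IsCMField.complexConj L) 1 (JW (↥(maximalRealSubfield L)) L ε) v u) : ↥(normOneUnits (conjLocal L (IsCMField.complexConj L) v))) :
            (UnitaryGroup.LocalRing L v)ˣ))⁻¹

/-! ## §2 The two registered stubs -/

set_option synthInstance.maxHeartbeats 400000 in
set_option maxHeartbeats 8000000 in
/-- **K1 (L; THE CORE) — the local theta type lies in the principal series of ITS OWN torus character.**  For a CM frame and a conjugate-symplectic `μ`, a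
character `χ_f` of `U(1)(𝔸_{L⁺,f})`, a NON-SPLIT `v` and a form congruence `ᵗT̄ H_v T = a Φ₃`: for some line class `ε` and some character `ψθ` of `E¹_v` satisfying ★
`CenterCharSpec` (i.e. `ψθ = χ_{f,v} · μ_v⁻¹` on `E¹_v`), some constituent `x₀` of `i_G(χθ)`, `χθ := cmXiTorusChar L v μ_v ψθ⁻¹ ψθ` (`χθ(d(α,β,ᾱ⁻¹)) = μ_v(α)‖α‖^{1/2}ψθ(β)`,
★ `xiTorusChar_apply`), transported to `U(H)(L⁺_v)`, IS the theta type `X_v(μ, ε, χ_f) ∘ κ_v⁻¹` (★ `ThetaTypeAtCM`).  PURELY LOCAL THETA: no `ξ`, `μω`, `η`, `ψ`.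
Print: Kudla's filtration of the Jacquet module of the Weil representation of `U(3) × U(1)` along the Borel of `U(3)` (top quotient `μ_v‖·‖^{1/2} ⊗ ω_{U(1)×U(1)}`), the
`U(1) × U(1)` occurrence selecting `ε`, and Frobenius reciprocity (★ `frobeniusEquiv`, PROVED).  Why it might fail as typed: a convention slip in `χθ` (run the audit K0 of the
design memo first) or missing ★ local irreducibility of `xThetaCM … v`. [cite: GelbartRogawski1991, §5.1 (5.1.1) p. 465, Lem. 5.1.2 pp. 465–466] [cite: Kudla1986, Thm. 2.8]
[cite: HarrisKudlaSweet1996, §6] [cite: Rogawski1990, §12.2 (2) p. 174] -/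
def StubThetaInPS : Prop :=
  ∀ (L : Type) [Field L] [NumberField L] [IsCMField L] (H : Matrix (Fin 3) (Fin 3) L) (hH : (H.map (cmConjRingHom L))ᵀ = H) (hHd : IsUnit H.det)
    {n' : ℕ} (e₁ : Fin 3 × Fin 1 ≃ Fin n') (dV : Fin 3 → L) (hdV : ∀ i, IsCMField.complexConj L (dV i) = dV i) (hdV0 : ∀ i, dV i ≠ 0) (g : GL (Fin 3) L)
    (hg : ((g : Matrix (Fin 3) (Fin 3) L).map (cmConjRingHom L))ᵀ * H * (g : Matrix (Fin 3) (Fin 3) L) = Matrix.diagonal dV),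
    ∀ (μ : Literature.NumberTheory.Automorphic.IdeleClassGroup L →ₜ* Circle) (hμ : IsConjugateSymplectic L μ)
      (χf : UnitaryGroup.finAdelicOne (↥(maximalRealSubfield L)) L (IsCMField.complexConj L) →* ℂˣ),
      Continuous χf → (∀ z, ‖((χf z : ℂˣ) : ℂ)‖ = 1) →
      ∀ (v : HeightOneSpectrum (𝓞 ↥(maximalRealSubfield L))),
        (∀ w : PlacesOver L v, IsCMField.complexConj L • w.1 = w.1) →
        ∀ (T : GL (Fin 3) (UnitaryGroup.LocalRing L v)) (a : UnitaryGroup.LocalRing L v) (ha : IsUnit a)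
          (h : formCongr (conjLocal L (IsCMField.complexConj L) v) T (H.map (algebraMap L (UnitaryGroup.LocalRing L v))) =
            a • (Matrix.of fun i j : Fin 3 => if i.val + j.val + 1 = 3 then (1 : L) else 0).map (algebraMap L (UnitaryGroup.LocalRing L v))),
          ∃ (ε : (↥(maximalRealSubfield L))ˣ) (x₀ : IrrClass (Gqs L v)) (ψθ : ↥(normOneUnits (conjLocal L (IsCMField.complexConj L) v)) →* ℂˣ),
            CenterCharSpec L μ χf ε v ψθ ∧
            x₀.IsConstituentOf (cmPrincipalSeries L 3 v (cmXiTorusChar L v ((toHeckeCharacter L μ).semilocalComponent L v) ψθ⁻¹ ψθ)) ∧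
            ThetaTypeAtCM L H e₁ dV hdV hdV0 g hg μ hμ χf ε v (IrrClass.comap (cmDatumLocalCongr L v T ha h).symm x₀)

set_option synthInstance.maxHeartbeats 400000 in
set_option maxHeartbeats 8000000 in
/-- **K2 (M) — THE DICTIONARY ALGEBRA: under the letter's two DICTIONARY hypotheses `ξ` ELIMINATES from `χ_ξ`.**  `χ_ξ(d(α,β,ᾱ⁻¹)) = η_v(α/ᾱ)·μω_v(α)·‖α‖^{1/2}·ψ_v((α/ᾱ)β)`
(★ `xiTorusChar_apply`, i = 0); DICTIONARY (μ) at `α` reads `μ_v(α) = η_v(α/ᾱ)ψ_v(α/ᾱ)μω_v(α)` (★ `cm_pullback_semilocalComponent`: `bcη_v(a) = η_v(a/ā)⁻¹`), so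
`χ_ξ(t) = μ_v(α)‖α‖^{1/2}ψ_v(β)`; DICTIONARY (χ_f) at a finite idèle supported at the place over `v` reads `χ_{f,v}(z/z̄) = ψ_v(z/z̄)·μ_v(z)²` and `μ_v(z)² = μ_v(z/z̄)`
(`μ` conjugate-symplectic ⟹ `μ(z z̄) = 1`), so `ψ_v = χ_{f,v}·μ_v⁻¹ = ψθ` on `E¹_v` (Hilbert 90: `z ↦ z/z̄` is onto `E¹_v` at a non-split `v`).  Hence
`cmXiTorusChar L v μω_v η_v ψ_v = cmXiTorusChar L v μ_v ψθ⁻¹ ψθ` for every `ψθ` with ★ `CenterCharSpec`.  Why it might fail: a slip in this derivation (then it is refuted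
fast, and the desk re-derives; K1 is insulated by the audit K0). [cite: Rogawski1990, §12.1 p. 172, §12.2 (2) p. 174] [cite: GelbartRogawski1991, §5.1 (5.1.1) p. 465] -/
def StubDictTorusChar : Prop :=
  ∀ (L : Type) [Field L] [NumberField L] [IsCMField L]
    (ξ : OneDimAutRepH L) (μω : HeckeCharacter L) (hμu : μω.IsUnitary),
    (∀ x : Literature.NumberTheory.GaloisRepresentations.ideleGroup ↥(maximalRealSubfield L),
        μω (AdeleRing.ideleBaseChange (↥(maximalRealSubfield L)) L x) = quadraticHeckeCharCM L x) →
    ∀ (μ : Literature.NumberTheory.Automorphic.IdeleClassGroup L →ₜ* Circle) (hμ : IsConjugateSymplectic L μ)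
      (χf : UnitaryGroup.finAdelicOne (↥(maximalRealSubfield L)) L (IsCMField.complexConj L) →* ℂˣ),
      Continuous χf → (∀ z, ‖((χf z : ℂˣ) : ℂ)‖ = 1) →
      -- DICTIONARY (μ): `μ̃ = η̃⁻¹ · ψ̃⁻¹ · μω`, semi-locally at every finite place of `L⁺`
      (∀ v : HeightOneSpectrum (𝓞 ↥(maximalRealSubfield L)),
          (toHeckeCharacter L μ).semilocalComponent L v = (ξ.bcη⁻¹ * ξ.bcψ⁻¹ * μω).semilocalComponent L v) →
      -- DICTIONARY (χ_f): `χ_f (z / z̄) = (ψ̃⁻¹ · (η̃⁻¹ ψ̃⁻¹ μω)²) ((1_∞, z))` for every finite idèle `z` of `L` (sign forced by the ★ split model)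
      (∀ z : (FiniteAdeleRing (𝓞 L) L)ˣ,
          χf (finAdelicCheck (↥(maximalRealSubfield L)) L (IsCMField.complexConj L)
              (AlgEquiv.ext fun x => by rw [AlgEquiv.mul_apply, IsCMField.complexConj_apply_apply, AlgEquiv.one_apply]) z) =
            (ξ.bcψ⁻¹ * (ξ.bcη⁻¹ * ξ.bcψ⁻¹ * μω) ^ 2)
              (Units.map (N := AdeleRing (𝓞 L) L) (MonoidHom.inr (InfiniteAdeleRing L) (FiniteAdeleRing (𝓞 L) L)) z)) →
      ∀ (v : HeightOneSpectrum (𝓞 ↥(maximalRealSubfield L))),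
        (∀ w : PlacesOver L v, IsCMField.complexConj L • w.1 = w.1) →
        ∀ (ε : (↥(maximalRealSubfield L))ˣ) (ψθ : ↥(normOneUnits (conjLocal L (IsCMField.complexConj L) v)) →* ℂˣ), CenterCharSpec L μ χf ε v ψθ →
          cmXiTorusChar L v (μω.semilocalComponent L v) (torusLocalComponent L (IsCMField.complexConj L) v ξ.η) (torusLocalComponent L (IsCMField.complexConj L) v ξ.ψ) =
            cmXiTorusChar L v ((toHeckeCharacter L μ).semilocalComponent L v) ψθ⁻¹ ψθ

set_option synthInstance.maxHeartbeats 400000 in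
set_option maxHeartbeats 16000000 in
open NumberField IsDedekindDomain MeasureTheory Literature.NumberTheory Literature.NumberTheory.Automorphic Literature.NumberTheory.Automorphic.UnitaryGroup Literature.NumberTheory.Automorphic.IdeleClassGroup Literature.NumberTheory.Automorphic.Liu2021 Literature.NumberTheory.Automorphic.Liu2021.Def411WeilCarriers Literature.NumberTheory.Automorphic.Liu2021.Def411WeilCarriersDoubling Literature.NumberTheory.GelbartRogawski1991.UnitaryDualPair Literature.NumberTheory.GelbartRogawski1991.UnitaryDualPair.WeilCoinv Literature.RepresentationTheory.Liu2021 Literature.NumberTheory.GaloisRepresentations Literature.NumberTheory.Rogawski1990 Literature.NumberTheory.GelbartRogawski1991 Literature.RepresentationTheory Summit.HodgeConjecture.HodgeConjecture.Cruxes.H413.F0P2oN3TorusWeightOfD3d in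
/-- **N3 (D) — the torus weight on the Jacquet module, ∀-closed — ★ CLOSED BY NAME** over A-p16 (g24)՚s (5c) ★ p836093 `F0P2oN3TorusWeightHolds.forall_jacquetModule_xThetaGqsCM_torus_eq_smul` (over (5b) ★ p835944 + the (D3d) bricks; edition v1.4; no `sorry`): «the diagonal torus element `m(γ) = d(γ, 1, γ̄⁻¹)` (`torusEntry … 1 t = 1`) acts on
`r_N(X_v(μ, ε, χ_f))` by `μ_w(γ)·‖γ‖_w^{1/2}` (`(toHeckeCharacter L μ).semilocalComponent L v γ * halfModulusChar _ γ`)» [Kudla1986 Thm. 2.8; Rogawski1990 §12.2 (2) p. 174; GelbartRogawski1991 §3.2 (3.2.2)].  TEXT = the binder `hD`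
of ★ p835661 TOKEN FOR TOKEN (tree lines :101–:117).  In-house road (D): A-p16 (g24)՚s (5b) CM-package wrapper `Theorems/F0P2oThetaJacquetTorusWeight.lean` ⇒ ★ `F0P2oN3TorusWeightOfD3d.thetaType_nonsplit_jacquetModule_b_of_kerWeight`. -/
theorem stub_N3D_letter :
    ∀ (L : Type) [Field L] [NumberField L] [IsCMField L]
      {n' : ℕ} (e₁ : Fin 3 × Fin 1 ≃ Fin n') (dV : Fin 3 → L) (hdV : ∀ i, IsCMField.complexConj L (dV i) = dV i) (hdV0 : ∀ i, dV i ≠ 0)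
      (μ : Literature.NumberTheory.Automorphic.IdeleClassGroup L →ₜ* Circle) (hμ : IsConjugateSymplectic L μ)
      (χf : UnitaryGroup.finAdelicOne (↥(maximalRealSubfield L)) L (IsCMField.complexConj L) →* ℂˣ),
      Continuous χf → (∀ z, ‖((χf z : ℂˣ) : ℂ)‖ = 1) →
      ∀ (v : HeightOneSpectrum (𝓞 ↥(maximalRealSubfield L))),
        (∀ w : PlacesOver L v, IsCMField.complexConj L • w.1 = w.1) →
        ∀ (ε : (↥(maximalRealSubfield L))ˣ)
          (T : GL (Fin 3) (UnitaryGroup.LocalRing L v)) (a : UnitaryGroup.LocalRing L v) (ha : IsUnit a)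
          (h : formCongr (conjLocal L (IsCMField.complexConj L) v) T ((Matrix.diagonal dV).map (algebraMap L (UnitaryGroup.LocalRing L v))) =
            a • (Matrix.of fun i j : Fin 3 => if i.val + j.val + 1 = 3 then (1 : L) else 0).map (algebraMap L (UnitaryGroup.LocalRing L v)))
          (t : ↥(cmBorelTriple L 3 v).M),
          torusEntry (conjLocal L (IsCMField.complexConj L) v) (cmLocalForm L 3 v) 1 t = 1 →
          ∀ x : ((cmBorelTriple L 3 v).restrict (xThetaGqsCM L e₁ dV hdV hdV0 μ hμ χf ε v T ha h)).Coinvariants,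
            Representation.jacquetModule (xThetaGqsCM L e₁ dV hdV hdV0 μ hμ χf ε v T ha h) (cmBorelTriple L 3 v) t x =
              (((toHeckeCharacter L μ).semilocalComponent L v (torusEntry (conjLocal L (IsCMField.complexConj L) v) (cmLocalForm L 3 v) 0 t) *
                  halfModulusChar (UnitaryGroup.LocalRing L v) (torusEntry (conjLocal L (IsCMField.complexConj L) v) (cmLocalForm L 3 v) 0 t) : ℂˣ) : ℂ) • x :=
  Summit.HodgeConjecture.HodgeConjecture.Cruxes.H413.F0P2oN3TorusWeightHolds.forall_jacquetModule_xThetaGqsCM_torus_eq_smul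

/-- **THE N3 LETTER — ★ CLOSED BY NAME, HYPOTHESIS-FREE** (edition v1.5 «N3 DIRECT FOLD» over ★ p839151 F0P2-p06 (g4) `Theorems/F0P2oLineJacquetHolds.lean :: thetaType_nonsplit_jacquetModule_holds` (the (JA) junction over ★ (C5) p838835 B-p10 (g23), ★ (C6)∕(J1)–(J4) p838314 B-p14 (g29) + `F0P2oLineJacquetReindex`, ★ (BE) p838099∕p838184 B-p18 (g29), ★ (N′) p837961 F0P2-p06 (g4), ★ (LS) p836839, ★ (LM) p836568, ★ (FX)(CC) p837171∕p837965, ★ (BF) p837182, ★ (BD) p838316, ★ (IB) p838392, ★ (KL) p838305, ★ (SJ-gen) p838357; lead B-p18 (g29) socket (B) word 2026-08-31T23:47:37Z) — the η-free (N′) line-Jacquet road; the clause-(a) stub `stub_N3a_letter` of v1.4 is DROPPED, `stub_N3D_letter` stays ★ by name; WAS: (D) proved in tree; edition v1.4 over ★ p835661 `F0P2oN3OfTorusWeight.thetaType_nonsplit_jacquetModule_of_a_of_torusWeight stub_N3a_letter stub_N3D_letter`; the whole letter was a print letter by name before) — (edition v1.2): [GelbartRogawski1991 §3.2 (3.2.1)–(3.2.2)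 p. 457; Kudla1986 Thm. 2.8] — ★-typed p826177 (typ-T7a (g0))
`Literature/NumberTheory/GelbartRogawski1991/ThetaTypeNonsplitJacquetModule.lean`; a `def … : Prop` named fact (print debt +1). Statement unchanged; no `sorry`. -/
theorem stub_N3_letter : Literature.NumberTheory.GelbartRogawski1991.thetaType_nonsplit_jacquetModule :=
  Summit.HodgeConjecture.HodgeConjecture.Cruxes.H413.F0P2oLineJacquetHolds.thetaType_nonsplit_jacquetModule_holds

/-- **THE K1w LETTER — ★ CLOSED BY NAME, HYPOTHESIS-FREE** (edition v1.3 over ★ p833012 `F0P2pK1wHolds.cmPrincipalSeries_isConstituentOf_weylConj_holds`; print letter by name at v1.2): [Rogawski1990 §12.2 p. 174 L3–5; BernsteinZelevinsky1977 Thm. 2.9] — ★-typed p826332 (typ-T7a (g0))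
`Literature/NumberTheory/Rogawski1990/U3PrincipalSeriesWeylConjugate.lean`; PROVED IN-HOUSE (F0P2-p06՚s K1w chain ★ F1 … F4c p832032 over ★ p832625 N1). Statement unchanged; no `sorry`. -/
theorem stub_K1w_letter : Literature.NumberTheory.Rogawski1990.cmPrincipalSeries_isConstituentOf_weylConj :=
  Summit.HodgeConjecture.HodgeConjecture.Cruxes.H413.F0P2pK1wHolds.cmPrincipalSeries_isConstituentOf_weylConj_holds

/-- **THE U1 LETTER — ★ CLOSED BY NAME MODULO N3 ONLY** (edition v1.3 over ★ p833094 `F0P2pGR91NOfN3.u1ThetaDichotomy_nonsplit_of_N3 stub_N3_letter`; print letter by name at v1.2): [HarrisKudlaSweet1996 Cor. 4.4 (m = n = 1) p. 962; Rogawski1992 Prop. 3.4; GelbartRogawski1991 Remark p. 466] — ★-typed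
p826953 ∕ ED.2 p827180 (typ-T7b (g0)) `Literature/NumberTheory/GelbartRogawski1991/U1ThetaDichotomy.lean`; PROVED IN-HOUSE «up the tower» (road (T) ★ COMPLETE: p829230 ∘ p832406∕p833741 ∘ p832625). Statement unchanged; no `sorry`. -/
theorem stub_U1_letter : Literature.NumberTheory.GelbartRogawski1991.u1ThetaDichotomy_nonsplit :=
  Summit.HodgeConjecture.HodgeConjecture.Cruxes.H413.F0P2pGR91NOfN3.u1ThetaDichotomy_nonsplit_of_N3 stub_N3_letter

set_option synthInstance.maxHeartbeats 400000 in
set_option maxHeartbeats 8000000 in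
/-- K1 — ★ CLOSED BY NAME OVER THE THREE LETTERS (edition v1.2): B-p18 (g28) p828142 `Theorems/F0P2oThetaInPSOfLetters.lean :: stubThetaInPS_of_letters (hN3) (hW) (hU1)`
(the K1 sub-line's head `k1_of_stubs` made by-name over ★ K1aʷ p828026, ★ K1w p826576, ★ K1c p827560, ★ K1b; `CenterCharSpec` is the composition's `IsThetaCenterChar` by δ-unfolding). -/
theorem stub_thetaType_in_principalSeries : StubThetaInPS :=
  Summit.HodgeConjecture.HodgeConjecture.Cruxes.H413.F0P2oThetaInPSOfLetters.stubThetaInPS_of_letters stub_N3_letter stub_K1w_letter stub_U1_letter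

set_option synthInstance.maxHeartbeats 400000 in
set_option maxHeartbeats 8000000 in
/-- K2 — ★ CLOSED BY NAME (edition v1.1): F0P2-p02 (g5) p826011 `Theorems/F0P2oStubDictTorusChar.lean :: stubDictTorusChar_holds`, letter-free
(character algebra over ★ `xiTorusChar_apply` ∕ ★ `cm_pullback_semilocalComponent` ∕ conjugate self-duality + local Hilbert 90 at a non-split place). -/
theorem stub_dictionary_torusChar : StubDictTorusChar :=
  Summit.HodgeConjecture.HodgeConjecture.Cruxes.H413.F0P2oStubDictTorusChar.stubDictTorusChar_holds

/-! ## §3 Composition (sorry-free): K1 → K2 → letter #76 -/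

set_option synthInstance.maxHeartbeats 400000 in
set_option maxHeartbeats 8000000 in
/-- **THE COMPOSITION**: the local theta statement K1 and the dictionary algebra K2 give print letter #76 verbatim. [cite: GelbartRogawski1991, §5.1 (5.1.1) p. 465, Lem. 5.1.2 pp. 465–466] -/
theorem GR91N_of_stubs (h1 : StubThetaInPS) (h2 : StubDictTorusChar) : GR91Lemma512NonsplitAsPrinted := by
  intro L _ _ _ H hH hHd n' e₁ dV hdV hdV0 g hg ξ μω hμu hquad μ hμ χf hcont hunit hdμ hdχ v hv T a ha h
  obtain ⟨ε, x₀, ψθ, hspec, hconst, hθ⟩ := h1 L H hH hHd e₁ dV hdV hdV0 g hg μ hμ χf hcont hunit v hv T a ha h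
  refine ⟨x₀, ?_, ε, hθ⟩
  rw [h2 L ξ μω hμu hquad μ hμ χf hcont hunit hdμ hdχ v hv ε ψθ hspec]
  exact hconst

/-- **THE CONCLUDER** (by name, the consumer's shape `stub_GR91N` of `Lines/F0_P2PKPiRung4.lean`). -/
theorem stubGR91N_of_K1K2 : GR91Lemma512NonsplitAsPrinted :=
  GR91N_of_stubs stub_thetaType_in_principalSeries stub_dictionary_torusChar

end Summit.HodgeConjecture.HodgeConjecture.Cruxes.H413.F0P2GR91NJacquet

end
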